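import Summits.ValiantsHypothesis.ValiantsHypothesis.Theorems.LacunarySymmetroidMatrixDescartesCensusWindowN
import Summits.ValiantsHypothesis.ValiantsHypothesis.Theorems.LacunarySymmetroidMatrixDescartesCensusSupportDescartes

/-!
# `MatrixDescartes` census — window rows in SUPPORT FORM at one repetition (distinct-root currency), (2,6)/(3,4) corollaries

HONEST FRAMING.  Object-search cell `pub-symmetroid`, route crux `Theses.LacunarySymmetroid.MatrixDescartes`
(ledger item stmt-ValiantsHypothesis-18050).  The tree's THEOREM N′ (`newton_window_of_alternating`, distinct positive
roots) restated for an ARBITRARY real polynomial in terms of its own support, in the ONE-SLACK regime the V = 19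
instruments use: if `#supp f ≤ #Z₊^{distinct}(f) + 2` and some pair of CONSECUTIVE support exponents carries coefficients
of the same sign (a repetition), then the weighted Newton row holds at every three consecutive support exponents with
alternating coefficients (`one_slack_window_support_card`; bookkeeping by `Finset.orderEmbOfFin`:
`exists_strictMono_enum_support`, `consecutive_eq_enum`, `weight_enum_eq`).  PENCIL COROLLARIES, support-free, for
EVERY exponent vector and ANY real letters: `nineteen_window_two_six_card` ((2,6): `#supp det ≤ 21` by the pair-sum
count, so 19 distinct positive roots + one consecutive repetition ⇒ the rows — engine-3 g15's door-A Case A row set) and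
`eighteen_window_three_four_card` ((3,4): `#supp det ≤ 20` by the triple-sum count).  The repetition-free sub-case and
the uniqueness of the repetition are the MULTIPLICITY statements of `…CensusWindowNMult/…WindowNSupport` (kernel-checked
in a combined scratch; filing waits on farm builds).  NECESSARY conditions on hypothetical nineteens / actual (3,4)
eighteens; no bound on `ζ_sym`, nothing on `DoorA26`/`DoorA34` (OPEN), the crux, or `VP ≠ VNP`.

[folklore] the cell's window lemma; support bookkeeping.
-/

-- `Summit.ValiantsHypothesis.ValiantsHypothesis.…` repeats a component by the D-0017 layout
-- (single-conjunct summit), which the `dupNamespace` linter flags; the name is mandated.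
set_option linter.dupNamespace false

namespace Summit.ValiantsHypothesis.ValiantsHypothesis.Theorems.LacunarySymmetroidMatrixDescartes.Census

open Polynomial Finset
open scoped BigOperators Polynomial

/-! ### Enumerating the support of a polynomial increasingly -/

/-- Every non-zero real polynomial is a fewnomial `Σ_{t<n} c_t X^{e_t}` over its sorted support: there is a
strictly increasing `e : ℕ → ℕ` enumerating `f.support` on `t < n = #supp f` (and continuing strictly beyond),
with `f = Σ_{t<n} C (f.coeff (e t)) X^{e t}`. (`Finset.orderEmbOfFin`, extended past `n`.) [folklore] -/
theorem exists_strictMono_enum_support (f : ℝ[X]) (hf : f ≠ 0) :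
    ∃ e : ℕ → ℕ, StrictMono e ∧ (∀ t, t < f.support.card → e t ∈ f.support) ∧
      (∀ x ∈ f.support, ∃ t, t < f.support.card ∧ e t = x) ∧
      f = ∑ t ∈ range f.support.card, C (f.coeff (e t)) * X ^ (e t) := by
  classical
  set n := f.support.card with hn
  have hn0 : 0 < n := Finset.card_pos.mpr (nonempty_support_iff.mpr hf)
  set emb := f.support.orderEmbOfFin hn.symm with hemb
  set e : ℕ → ℕ := fun t => if h : t < n then emb ⟨t, h⟩ else f.natDegree + 1 + (t - n) with he
  have he_lt : ∀ t (h : t < n), e t = emb ⟨t, h⟩ := fun t h => by simp only [he, dif_pos h]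
  have he_ge : ∀ t, n ≤ t → e t = f.natDegree + 1 + (t - n) := fun t h => by
    simp only [he, dif_neg (not_lt.mpr h)]
  have hmem : ∀ t (h : t < n), e t ∈ f.support := fun t h => by
    rw [he_lt t h]; exact Finset.orderEmbOfFin_mem _ _ _
  have hmono : StrictMono e := by
    intro a b hab
    by_cases hb : b < n
    · rw [he_lt a (hab.trans hb), he_lt b hb]
      exact emb.strictMono (Fin.mk_lt_mk.mpr hab)
    · rw [not_lt] at hb
      rw [he_ge b hb]
      by_cases ha : a < n
      · rw [he_lt a ha]
        have : (emb ⟨a, ha⟩ : ℕ) ≤ f.natDegree := le_natDegree_of_mem_supp _ (Finset.orderEmbOfFin_mem _ _ _)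
        omega
      · rw [not_lt] at ha
        rw [he_ge a ha]; omega
  refine ⟨e, hmono, fun t ht => hmem t ht, fun x hx => ?_, ?_⟩
  · have : x ∈ Set.range emb := by rw [Finset.range_orderEmbOfFin]; exact hx
    obtain ⟨i, hi⟩ := this
    exact ⟨i.1, i.2, by rw [he_lt i.1 i.2]; exact hi⟩
  · conv_lhs => rw [as_sum_support_C_mul_X_pow f]
    symm
    refine Finset.sum_nbij e (fun t ht => hmem t (mem_range.mp ht)) ?_ ?_ (fun t _ => rfl)
    · intro a ha b hb hab
      exact hmono.injective hab
    · intro x hx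
      have : x ∈ Set.range emb := by rw [Finset.range_orderEmbOfFin]; exact hx
      obtain ⟨i, hi⟩ := this
      exact ⟨i.1, by simp only [coe_range, Set.mem_Iio]; exact i.2, by rw [he_lt i.1 i.2]; exact hi⟩

/-- With `e` as in `exists_strictMono_enum_support`: two CONSECUTIVE support exponents `a < b` (no support
element strictly between) are `e t`, `e (t+1)` for some `t + 1 < #supp f`. [folklore] -/
theorem consecutive_eq_enum {f : ℝ[X]} {e : ℕ → ℕ} (he : StrictMono e)
    (hmem : ∀ t, t < f.support.card → e t ∈ f.support)
    (hsurj : ∀ x ∈ f.support, ∃ t, t < f.support.card ∧ e t = x)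
    {a b : ℕ} (ha : a ∈ f.support) (hb : b ∈ f.support) (hab : a < b)
    (hcons : ∀ u ∈ f.support, ¬ (a < u ∧ u < b)) :
    ∃ t, t + 1 < f.support.card ∧ e t = a ∧ e (t + 1) = b := by
  obtain ⟨i, hi, rfl⟩ := hsurj a ha
  obtain ⟨j, hj, rfl⟩ := hsurj b hb
  have hij : i < j := he.lt_iff_lt.mp hab
  have hj1 : j = i + 1 := by
    by_contra hne
    have hlt : i + 1 < j := by omega
    exact hcons (e (i + 1)) (hmem (i + 1) (by omega)) ⟨he (Nat.lt_succ_self i), he hlt⟩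
  subst hj1
  exact ⟨i, hj, rfl, rfl⟩

/-- Weight transport: with `e` as in `exists_strictMono_enum_support`, the window weight over `range n` at index
`t` equals the weight over the support at the exponent `e t`. [folklore] -/
theorem weight_enum_eq {f : ℝ[X]} {e : ℕ → ℕ} (he : StrictMono e)
    (hmem : ∀ t, t < f.support.card → e t ∈ f.support)
    (hsurj : ∀ x ∈ f.support, ∃ t, t < f.support.card ∧ e t = x) (t : ℕ) :
    (∏ u ∈ range f.support.card, (if u = t then (1 : ℝ) else |(e t : ℝ) - e u|)) =
      ∏ x ∈ f.support, (if x = e t then (1 : ℝ) else |(e t : ℝ) - x|) := by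
  refine Finset.prod_nbij e (fun u hu => hmem u (mem_range.mp hu)) ?_ ?_ ?_
  · intro a _ b _ hab; exact he.injective hab
  · intro x hx
    obtain ⟨u, hu, hux⟩ := hsurj x hx
    exact ⟨u, by simp only [coe_range, Set.mem_Iio]; exact hu, hux⟩
  · intro u _
    by_cases hut : u = t
    · subst hut; simp
    · rw [if_neg hut, if_neg (fun h => hut (he.injective h))]

/-! ### Support sizes of (2,6) and (3,4) determinants -/

/-- The pair-sum table of six exponents has at most `21` distinct values. [folklore] -/
theorem card_pairSums_six_le (d : Fin 6 → ℕ) :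
    ((Finset.univ : Finset (Fin 2 → Fin 6)).image (fun f => ∑ i, d (f i))).card ≤ 21 := by
  classical
  have hsub : (Finset.univ : Finset (Fin 2 → Fin 6)).image (fun f => ∑ i, d (f i)) ⊆
      ((Finset.univ : Finset (Fin 6 × Fin 6)).filter (fun p => p.1 ≤ p.2)).image (fun p => d p.1 + d p.2) := by
    intro x hx
    obtain ⟨g, _, rfl⟩ := Finset.mem_image.mp hx
    rw [Fin.sum_univ_two]
    rcases le_total (g 0) (g 1) with h | h
    · exact Finset.mem_image.mpr ⟨(g 0, g 1), Finset.mem_filter.mpr ⟨Finset.mem_univ _, h⟩, rfl⟩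
    · exact Finset.mem_image.mpr ⟨(g 1, g 0), Finset.mem_filter.mpr ⟨Finset.mem_univ _, h⟩, by
        simp only; ring⟩
  have hcard : ((Finset.univ : Finset (Fin 6 × Fin 6)).filter (fun p => p.1 ≤ p.2)).card = 21 := by decide
  exact (Finset.card_le_card hsub).trans (Finset.card_image_le.trans hcard.le)

/-- The triple-sum table of four exponents has at most `20` distinct values (sort an ordered triple by
min / median / max). [folklore] -/
theorem card_tripleSums_four_le (d : Fin 4 → ℕ) :
    ((Finset.univ : Finset (Fin 3 → Fin 4)).image (fun f => ∑ i, d (f i))).card ≤ 20 := by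
  classical
  have hsort : ∀ a b c : Fin 4, d a + d b + d c =
      d (min a (min b c)) + d (max (min a b) (min (max a b) c)) + d (max a (max b c)) := by
    intro a b c
    fin_cases a <;> fin_cases b <;> fin_cases c <;> simp (config := { decide := true }) <;> ring
  have hsorted : ∀ a b c : Fin 4, min a (min b c) ≤ max (min a b) (min (max a b) c) ∧
      max (min a b) (min (max a b) c) ≤ max a (max b c) := by decide
  have hsub : (Finset.univ : Finset (Fin 3 → Fin 4)).image (fun f => ∑ i, d (f i)) ⊆
      ((Finset.univ : Finset (Fin 4 × Fin 4 × Fin 4)).filter (fun p => p.1 ≤ p.2.1 ∧ p.2.1 ≤ p.2.2)).image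
        (fun p => d p.1 + d p.2.1 + d p.2.2) := by
    intro x hx
    obtain ⟨g, _, rfl⟩ := Finset.mem_image.mp hx
    rw [Fin.sum_univ_three]
    exact Finset.mem_image.mpr ⟨(min (g 0) (min (g 1) (g 2)), max (min (g 0) (g 1)) (min (max (g 0) (g 1)) (g 2)),
      max (g 0) (max (g 1) (g 2))), Finset.mem_filter.mpr ⟨Finset.mem_univ _, hsorted _ _ _⟩, (hsort _ _ _).symm⟩
  have hcard : ((Finset.univ : Finset (Fin 4 × Fin 4 × Fin 4)).filter
      (fun p => p.1 ≤ p.2.1 ∧ p.2.1 ≤ p.2.2)).card = 20 := by decide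
  exact (Finset.card_le_card hsub).trans (Finset.card_image_le.trans hcard.le)

/-- **(2,6): the determinant has at most 21 monomials.**  For every `d : Fin 6 → ℕ` and every six real `2 × 2`
matrices, `#supp det (Σ_l X^{d l} S l) ≤ 21` (support ⊆ pair sums). [folklore] -/
theorem card_support_det_two_six_le (d : Fin 6 → ℕ) (S : Fin 6 → Matrix (Fin 2) (Fin 2) ℝ) :
    (Matrix.det (∑ l, ((Polynomial.X : Polynomial ℝ) ^ d l) • (S l).map Polynomial.C)).support.card ≤ 21 :=
  (Finset.card_le_card (support_det_pencil_subset_sumset d S)).trans (card_pairSums_six_le d)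

/-- **(3,4): the determinant has at most 20 monomials.** [folklore] -/
theorem card_support_det_three_four_le (d : Fin 4 → ℕ) (S : Fin 4 → Matrix (Fin 3) (Fin 3) ℝ) :
    (Matrix.det (∑ l, ((Polynomial.X : Polynomial ℝ) ^ d l) • (S l).map Polynomial.C)).support.card ≤ 20 :=
  (Finset.card_le_card (support_det_pencil_subset_sumset d S)).trans (card_tripleSums_four_le d)

/-! ### The window lemma in support form, one repetition, distinct currency -/

/-- With one adjacent repetition at `k` (`c_k c_{k+1} > 0`, `k + 1 < n`) the alternation count of `(c_t)_{t<n}` is at most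
`n − 2`. [folklore] -/
theorem sum_alternating_le_of_repetition {n k : ℕ} (c : ℕ → ℝ) (hk : k + 1 < n) (hrep : 0 < c k * c (k + 1)) :
    (∑ t ∈ range (n - 1), (if c t * c (t + 1) < 0 then 1 else 0)) ≤ n - 2 := by
  rw [Finset.sum_boole]
  have hsub : (range (n - 1)).filter (fun t => c t * c (t + 1) < 0) ⊆ (range (n - 1)).erase k := by
    intro t ht
    rw [Finset.mem_filter] at ht
    refine Finset.mem_erase.mpr ⟨?_, ht.1⟩
    rintro rfl; linarith [ht.2]
  have := Finset.card_le_card hsub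
  rw [Finset.card_erase_of_mem (mem_range.mpr (by omega)), Finset.card_range] at this
  push_cast
  omega

/-- **WINDOW LEMMA, SUPPORT FORM, ONE REPETITION (distinct roots).**  Let `f ∈ ℝ[X]` have
`#supp f ≤ #Z₊^{distinct}(f) + 2` and let `a₀ < b₀` be CONSECUTIVE support exponents with `f_{a₀} f_{b₀} > 0` (a sign
repetition).  Then at every three consecutive support exponents `a < b < c` with `f_a f_b < 0`, `f_b f_c < 0` the weighted
Newton row holds on the support: `(|f_a| W_a)^{c−b} (|f_c| W_c)^{b−a} ≤ (|f_b| W_b)^{c−a}`, `W_x = ∏_{u ∈ supp f, u≠x} |x − u|`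
(the alternation count is `≤ #supp − 2 ≤ #Z₊^{distinct}`, so THEOREM N′ applies). [folklore] -/
theorem one_slack_window_support_card (f : ℝ[X])
    (hZ : f.support.card ≤ (f.roots.toFinset.filter (fun x => 0 < x)).card + 2)
    {a₀ b₀ : ℕ} (ha₀ : a₀ ∈ f.support) (hb₀ : b₀ ∈ f.support) (hab₀ : a₀ < b₀)
    (hcons₀ : ∀ u ∈ f.support, ¬ (a₀ < u ∧ u < b₀)) (hrep : 0 < f.coeff a₀ * f.coeff b₀)
    {a b c : ℕ} (ha : a ∈ f.support) (hb : b ∈ f.support) (hc : c ∈ f.support) (hab : a < b) (hbc : b < c)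
    (hcons₁ : ∀ u ∈ f.support, ¬ (a < u ∧ u < b)) (hcons₂ : ∀ u ∈ f.support, ¬ (b < u ∧ u < c))
    (h1 : f.coeff a * f.coeff b < 0) (h2 : f.coeff b * f.coeff c < 0) :
    (|f.coeff a| * ∏ u ∈ f.support, (if u = a then (1 : ℝ) else |(a : ℝ) - u|)) ^ (c - b) *
      (|f.coeff c| * ∏ u ∈ f.support, (if u = c then (1 : ℝ) else |(c : ℝ) - u|)) ^ (b - a)
    ≤ (|f.coeff b| * ∏ u ∈ f.support, (if u = b then (1 : ℝ) else |(b : ℝ) - u|)) ^ (c - a) := by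
  classical
  have hf : f ≠ 0 := by rintro rfl; simp at ha
  obtain ⟨e, he, hmem, hsurj, hsum⟩ := exists_strictMono_enum_support f hf
  set n := f.support.card with hn
  obtain ⟨t, ht, rfl, rfl⟩ := consecutive_eq_enum he hmem hsurj ha hb hab hcons₁
  obtain ⟨t', ht', het', rfl⟩ := consecutive_eq_enum he hmem hsurj hb hc hbc hcons₂
  obtain rfl : t' = t + 1 := he.injective het'
  obtain ⟨k, hk, rfl, rfl⟩ := consecutive_eq_enum he hmem hsurj ha₀ hb₀ hab₀ hcons₀
  have hn3 : 3 ≤ n := by omega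
  have hcoef : ∀ s, s < n → f.coeff (e s) ≠ 0 := fun s hs => mem_support_iff.mp (hmem s hs)
  have hZ' : (∑ s ∈ range (n - 1), (if f.coeff (e s) * f.coeff (e (s + 1)) < 0 then 1 else 0)) ≤
      ((∑ s ∈ range n, C (f.coeff (e s)) * X ^ (e s) : ℝ[X]).roots.toFinset.filter (fun x => 0 < x)).card := by
    have h1' := sum_alternating_le_of_repetition (n := n) (fun s => f.coeff (e s)) hk hrep
    rw [← hsum]; omega
  have key := newton_window_of_alternating n hn3 e he (fun s => f.coeff (e s)) hcoef hZ' t (by omega) h1 h2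
  rw [weight_enum_eq he hmem hsurj t, weight_enum_eq he hmem hsurj (t + 1),
    weight_enum_eq he hmem hsurj (t + 1 + 1)] at key
  exact key

/-- **NINETEEN WINDOW THEOREM (2,6), one repetition, distinct currency — the door-A Case A row set, support-free.**
For EVERY `d : Fin 6 → ℕ` and EVERY six real `2 × 2` matrices `S l` (symmetric or not): if `f = det (Σ_l X^{d l} S l)` has
at least `19` distinct positive roots and two CONSECUTIVE support exponents `a₀ < b₀` carry same-sign coefficients, then at
every three consecutive support exponents with alternating coefficients the weighted Newton row holds on the support of `f`
(`#supp f ≤ 21 ≤ 19 + 2`).  The repetition-free sub-case («V = 20 with a double root») and «at most one repetition» are the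
multiplicity statements of `…CensusWindowNSupport`.  NECESSARY condition; `DoorA26` OPEN. [folklore] -/
theorem nineteen_window_two_six_card (d : Fin 6 → ℕ) (S : Fin 6 → Matrix (Fin 2) (Fin 2) ℝ) {f : ℝ[X]}
    (hf : f = Matrix.det (∑ l, ((Polynomial.X : Polynomial ℝ) ^ d l) • (S l).map Polynomial.C))
    (hZ : 19 ≤ (f.roots.toFinset.filter (fun t => 0 < t)).card)
    {a₀ b₀ : ℕ} (ha₀ : a₀ ∈ f.support) (hb₀ : b₀ ∈ f.support) (hab₀ : a₀ < b₀)
    (hcons₀ : ∀ u ∈ f.support, ¬ (a₀ < u ∧ u < b₀)) (hrep : 0 < f.coeff a₀ * f.coeff b₀)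
    {a b c : ℕ} (ha : a ∈ f.support) (hb : b ∈ f.support) (hc : c ∈ f.support) (hab : a < b) (hbc : b < c)
    (hcons₁ : ∀ u ∈ f.support, ¬ (a < u ∧ u < b)) (hcons₂ : ∀ u ∈ f.support, ¬ (b < u ∧ u < c))
    (h1 : f.coeff a * f.coeff b < 0) (h2 : f.coeff b * f.coeff c < 0) :
    (|f.coeff a| * ∏ u ∈ f.support, (if u = a then (1 : ℝ) else |(a : ℝ) - u|)) ^ (c - b) *
      (|f.coeff c| * ∏ u ∈ f.support, (if u = c then (1 : ℝ) else |(c : ℝ) - u|)) ^ (b - a)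
    ≤ (|f.coeff b| * ∏ u ∈ f.support, (if u = b then (1 : ℝ) else |(b : ℝ) - u|)) ^ (c - a) := by
  have h21 := card_support_det_two_six_le d S
  rw [← hf] at h21
  exact one_slack_window_support_card f (by omega) ha₀ hb₀ hab₀ hcons₀ hrep ha hb hc hab hbc hcons₁ hcons₂ h1 h2

/-- **EIGHTEEN WINDOW THEOREM (3,4), one repetition, distinct currency.**  For EVERY `d : Fin 4 → ℕ` and EVERY four real
`3 × 3` matrices `S l`: if `f = det (Σ_l X^{d l} S l)` has at least `18` distinct positive roots (`#supp f ≤ 20 ≤ 18 + 2`) and a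
consecutive same-sign pair, then the weighted Newton rows hold at every alternating consecutive support triple — an INHABITED
layer (the twelve census (3,4) eighteens: one repetition each, 192/192 rows, engine-6 g17 `window_check.py`).  `DoorA34` OPEN.
[folklore] -/
theorem eighteen_window_three_four_card (d : Fin 4 → ℕ) (S : Fin 4 → Matrix (Fin 3) (Fin 3) ℝ) {f : ℝ[X]}
    (hf : f = Matrix.det (∑ l, ((Polynomial.X : Polynomial ℝ) ^ d l) • (S l).map Polynomial.C))
    (hZ : 18 ≤ (f.roots.toFinset.filter (fun t => 0 < t)).card)
    {a₀ b₀ : ℕ} (ha₀ : a₀ ∈ f.support) (hb₀ : b₀ ∈ f.support) (hab₀ : a₀ < b₀)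
    (hcons₀ : ∀ u ∈ f.support, ¬ (a₀ < u ∧ u < b₀)) (hrep : 0 < f.coeff a₀ * f.coeff b₀)
    {a b c : ℕ} (ha : a ∈ f.support) (hb : b ∈ f.support) (hc : c ∈ f.support) (hab : a < b) (hbc : b < c)
    (hcons₁ : ∀ u ∈ f.support, ¬ (a < u ∧ u < b)) (hcons₂ : ∀ u ∈ f.support, ¬ (b < u ∧ u < c))
    (h1 : f.coeff a * f.coeff b < 0) (h2 : f.coeff b * f.coeff c < 0) :
    (|f.coeff a| * ∏ u ∈ f.support, (if u = a then (1 : ℝ) else |(a : ℝ) - u|)) ^ (c - b) *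
      (|f.coeff c| * ∏ u ∈ f.support, (if u = c then (1 : ℝ) else |(c : ℝ) - u|)) ^ (b - a)
    ≤ (|f.coeff b| * ∏ u ∈ f.support, (if u = b then (1 : ℝ) else |(b : ℝ) - u|)) ^ (c - a) := by
  have h20 := card_support_det_three_four_le d S
  rw [← hf] at h20
  exact one_slack_window_support_card f (by omega) ha₀ hb₀ hab₀ hcons₀ hrep ha hb hc hab hbc hcons₁ hcons₂ h1 h2

end Summit.ValiantsHypothesis.ValiantsHypothesis.Theorems.LacunarySymmetroidMatrixDescartes.Census
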